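import Mathlib
import HarnessLib
import HarnessLib.Audit
import Summits.Schanuel.Statement
import Literature.NumberTheory.Transcendental.ZilberField
import HarnessLib.Audit.Status.Attr

/-!
Route: TwistedConjugacy

# Route TwistedConjugacy — exp wildly conjugate to exp∘μ (Denis's change of variable, transferred) +
Schanuel relative to E(2πi)

It suffices to show X = TwistedSymmetry ∧ RelSchanuelOverTowerPi. TWISTED SYMMETRY (TS): for ONE
algebraic μ with |μ| = 1, not a root
of unity, there is a ring endomorphism σ of ℂ fixing every algebraic number with σ(e^z) = e^{μ·σ(z)}
for all z — "exp is (wildly)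
conjugate to its rescaling exp∘μ". This is the exact char-0 transfer of the lever in Denis's THEOREM
that the Carlitz analogues of e and
π are algebraically independent (Denis1995 Thm 3 / Cor 2: the continuous automorphism T ↦ ξT of
F_q((1/T)) fixes π̃ and 1 but carries
the Carlitz exponential to e(μ·)/μ, μ ∉ F_q; Thiery's LW finishes). What breaks in char 0: Aut(ℤ) =
1, complex conjugation commutes
with exp — so σ must be wild; Zilber's categoricity makes TS a theorem of every uncountable Zilber
field (TwistInZilberFields), hence a
prediction of ℂ_exp ≅ 𝔹. TS alone decides Schanuel on the sector E ⊕ ℚ·2πi (E = exp-closure of ℚ̄):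
the σ-orbit of a tower element is
the exp-DEFORMATION family m ↦ ev_m(T) (read exp as u ↦ e^{mu}) sampled on μ^ℕ, dense in S¹, so the
identity theorem turns a numerical
relation into a functional one and Ax's theorem finishes (TwistImpliesTowerPi); the remainder is
Schanuel relative to E(2πi).
Lean: `(∃ μ : ℂ, IsAlgebraic ℚ μ ∧ ‖μ‖ = 1 ∧ (∀ n : ℕ, 0 < n → μ ^ n ≠ 1) ∧ ∃ σ : ℂ →+* ℂ, (∀ a : ℂ,
IsAlgebraic ℚ a → σ a = a) ∧ ∀ z : ℂ, σ (Complex.exp z) = Complex.exp (μ * σ z)) ∧ (∀ (n : ℕ) (z :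
Fin n → ℂ), (∀ (q : Fin n → ℚ) (r : ℚ), (∑ i, (q i : ℂ) * z i) + (r : ℂ) * (2 * (Real.pi : ℂ) *
Complex.I) ∈ (sInf {K : IntermediateField ℚ ℂ | algebraicClosure ℚ ℂ ≤ K ∧ ∀ w ∈ K, Complex.exp w ∈
K} : IntermediateField ℚ ℂ) → q = 0) → (n : Cardinal) ≤ Algebra.trdeg ↥(IntermediateField.adjoin ℚ
(((sInf {K : IntermediateField ℚ ℂ | algebraicClosure ℚ ℂ ≤ K ∧ ∀ w ∈ K, Complex.exp w ∈ K} :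
IntermediateField ℚ ℂ) : Set ℂ) ∪ {2 * (Real.pi : ℂ) * Complex.I})) ↥(IntermediateField.adjoin
↥(IntermediateField.adjoin ℚ (((sInf {K : IntermediateField ℚ ℂ | algebraicClosure ℚ ℂ ≤ K ∧ ∀ w ∈
K, Complex.exp w ∈ K} : IntermediateField ℚ ℂ) : Set ℂ) ∪ {2 * (Real.pi : ℂ) * Complex.I}))
(Set.range z ∪ Set.range (Complex.exp ∘ z))))`

## Assembly
Field-theoretic bookkeeping (paper-checked, L in Lean): given ℚ-linearly independent z, let V =
span_ℚ z and V₀ = V ∩ (E + ℚ·2πi); choose a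
ℚ-basis c of V₀ and extend by w (ℚ-independent modulo E + ℚ2πi), m + r = n, rescaling so that every
zᵢ is a ℤ-combination of (c, w). Then
ℚ(z, e^z) and ℚ(c, w, e^c, e^w) have the same algebraic closure, and trdeg ℚ(c,w,e^c,e^w) = trdeg
ℚ(c,e^c) + trdeg_{ℚ(c,e^c)}(w,e^w) ≥ m +
trdeg_{E(2πi)} E(2πi)(w,e^w) ≥ m + r, using TowerPiSchanuel for c, the inclusion ℚ(c, e^c) ⊆ E(2πi)
(c ∈ E + ℚ2πi, e^c ∈ e^E·μ_∞ ⊆ E; base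
change only lowers trdeg) and RelSchanuelOverTowerPi for w. The deciding theorem is closes :
TwistImpliesTowerPi → TwistedSymmetry →
RelSchanuelOverTowerPi → Assembly → Schanuel (both cruxes are premises).

Rationale: WHY THIS LINE. Operator "adjacent transfer": the (e, π)-instance of Schanuel is a THEOREM in
characteristic p (Denis1995 Cor 2(a), q ≥ 3; Pellarin2017 §2
surveys: Carlitz–Schanuel itself is open), and the proof is not Mahler/Frobenius (as the closed card
nome-one-over-e assumed) but a SYMMETRY:
the ambient automorphism σ_ξ : T ↦ ξT of k_∞ fixes k, 1 and π̃ and intertwines e with the twisted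
exponential e_ξ(z) = e(μz)/μ, μ^{q−1} = 1/ξ,
μ ∉ F_q (Denis1995 Lemma 16), so "e(1) algebraic over k(π̃)" propagates to "e(μ) algebraic over
k(π̃)" and Thiery's Lindemann–Weierstrass
kills it; dictionary F_q[T] ↦ ℤ, F_q^× = Aut-relevant units ↦ ℤ^× = {±1}, σ_ξ ↦ σ, e_ξ ↦ exp∘μ,
Thiery ↦ LW (tree `LindemannWeierstrass.AlgIndep_holds`),
Becker–Brownawell–Tubbs ↦ Gel'fond–Schneider (tree `gelfond_schneider_holds`). Exactly one thing
breaks — char 0 has no continuous twisting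
automorphism (n! ∈ ℚ is fixed by everything) — and the crux TS posits the wild one; imported areas:
transcendence in positive characteristic,
model theory of exponential fields (Zilber2005 categoricity, BaysKirby2018ANT, Mantova2011: "Zilber
fields have many automorphisms; the only
automorphism of ℂ_exp we know is conjugation"), one-variable complex analysis (identity theorem) and
Ax1971. What no prior route does:
CyclotomicRigidity extends UNtwisted Galois automorphisms up E and uses χ_cyc to keep π OUT (its
GalExtTower is implied by TowerSchanuel);
here the twist μ reaches π (σ(2πi) = 2πi/μ), TS IMPLIES TowerSchanuel-with-π, e ⊥ π (Denis
verbatim), homogeneity of all relations among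
logarithms of algebraic numbers and two-log independence (TS + Gel'fond–Schneider); RigidCore works
with Aut(ℂ_exp), which fixes e and π.

RANKED CRUXES. #2 TwistedSymmetry (crux) — there exist an algebraic μ ∈ ℂ with |μ| = 1, μ not a root
of unity, and a ring endomorphism σ : ℂ → ℂ fixing every algebraic number pointwise with σ(exp z) =
exp(μ·σ z) for all z ("exp is wildly conjugate to exp∘μ"; the transferred Denis automorphism).
[difficulty: open-problem] (why it might fail: false iff ℂ_exp ≇ (ℂ, exp∘μ) over ℚ̄ — refutes
Zilber's ℂ_exp ≅ 𝔹 (both satisfy his axioms); it forces e⊥π, log2⊥log3, TowerSchanuel; no wild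
exp-semilinear endomorphism of ℂ has ever been built (Aut ℂ_exp ⊋ {1,c} open).) [Denis1995,
Zilber2005, BaysKirby2018ANT, Mantova2011, KirbyMacintyreOnshuus2012]
#3 RelSchanuelOverTowerPi (crux) — Schanuel relative to the base field E(2πi), E the exp-closure of
ℚ̄: if z₁,…,zₙ are ℚ-linearly independent modulo E + ℚ·2πi, then trdeg over E(2πi) of E(2πi)(z, e^z)
is ≥ n. The honest remainder once TS has absorbed the tower and π; strictly weaker than
CyclotomicRigidity's TowerStrong ∧ PiNotInTower. [difficulty: open-problem] (why it might fail: iff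
Schanuel fails off the sector E ⊕ ℚ2πi: contains log 2 ⊥ log 3 over E (barrier
AlgebraicIndependenceOfLogarithms in full), log π, implicit Khovanskii points; TS only removes
inhomogeneous log relations there — no engine for the rest.) [Kirby2010, Waldschmidt2000, Lang1966,
Kirby2013FPEF]
#9 TowerPiSchanuel (support) — SCHANUEL ON THE SECTOR E ⊕ ℚ·2πi: for z₁,…,zₙ ℚ-linearly independent
with each zᵢ ∈ E + ℚ·2πi, trdeg ℚ(z, e^z) ≥ n (contains CyclotomicRigidity's TowerSchanuel, e ⊥ e^e,
e ⊥ π, and "π free over the tower"); the consequent of TwistImpliesTowerPi, filed as its own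
statement. [difficulty: open-problem] [Macintyre1991, Kirby2013FPEF, Lang1966]
#9 TwistImpliesTowerPi (support) — THE DEFORMATION THEOREM (paper proof in NOTES.md §Deformation):
TwistedSymmetry → TowerPiSchanuel. For an exp-term T over ℚ̄ and the twisted σ, σ^k(ev₁ T) =
ev_{μ^k}(T) where ev_m reads exp as u ↦ e^{mu}, and σ^k(2πi) = 2πi/μ^k; a ℚ-relation P(z, e^z) = 0
therefore holds along m ∈ μ^ℕ, dense in S¹; each m ↦ ev_m(T) is analytic off a countable closed set,
so the identity theorem gives P ≡ 0 in m, and Ax's theorem (tree `ax_schanuel`, derivation d/dm, y =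
m·ev_m(T), z = e^y) plus "m is transcendental over the deformation field" (Ax induction) yield trdeg
≥ n. [difficulty: XL] [Ax1971, Denis1995, Kirby2013FPEF, Mathlib:
AnalyticOnNhd.eqOn_zero_of_preconnected_of_frequently_eq_zero]
#9 TwistImpliesEPi (support) — FIRST DELIVERABLE, Denis's argument verbatim (provable now, M):
TwistedSymmetry → e and π algebraically independent. σ fixes ζ_N = e^{2πi/N} for all N, so σ(2πi) =
2πi/μ and σ(π) = π/μ; if Q(π, e) = 0 then σ^k gives Q(π/μ^k, e^{μ^k}) = 0, so every e^{μ^k} is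
algebraic over ℚ(π); μ ∉ ℚ has degree d ≥ 2 and LW (tree `LindemannWeierstrass.AlgIndep_holds`)
makes e, e^μ, …, e^{μ^{d−1}} algebraically independent inside a field of trdeg 1 — contradiction.
[difficulty: provable-now] [Denis1995, Weierstrass1885, BakerTNT1975, tree:
Literature.NumberTheory.Transcendental.LindemannWeierstrass.AlgIndep_holds]
#9 TwistImpliesPiFree (support) — π IS FREE OVER THE LINDEMANN–WEIERSTRASS VALUES (provable, L):
TwistedSymmetry → for algebraic α₁,…,αₙ ℚ-linearly independent, trdeg ℚ(π, e^{α₁},…,e^{αₙ}) = n+1.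
One-μ proof by deformation: P(2πi/m, e^{mα}) vanishes on μ^ℕ ⊂ S¹ (dense), hence identically; 1/m
and the e^{mαᵢ} are algebraically independent functions (Ax), so P = 0. (The GaussianStokesSector
sector statement, reached by symmetry instead of Stokes data; CyclotomicRigidity's LWWithPi is its
linear shadow.) [difficulty: L] [Denis1995, Ax1971, Waldschmidt2004, tree:
Literature.NumberTheory.Transcendental.LindemannWeierstrass.AlgIndep_holds]
#9 TwistImpliesLogHomogeneity (support) — BAKER'S INHOMOGENEITY PRINCIPLE IN ALL DEGREES (provable
now, S): TwistedSymmetry → every ℚ-polynomial relation P(ℓ) = 0 among logarithms ℓⱼ of algebraic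
numbers (e^{ℓⱼ} ∈ ℚ̄; no independence hypothesis) holds homogeneous component by component. Proof:
all roots e^{ℓⱼ/N} are algebraic hence σ-fixed, forcing σ(ℓⱼ) = ℓⱼ/μ exactly; so P(ℓ/μ^k) = Σ_d
μ^{−kd} P_d(ℓ) = 0 for k = 0..deg P, a Vandermonde system in the distinct nodes μ^{−d}. [difficulty:
provable-now] [Denis1995, BakerTNT1975, Mathlib: Matrix.det_vandermonde]
#9 TwistImpliesTwoLogs (support) — TWO ALGEBRAICALLY INDEPENDENT LOGARITHMS FROM SYMMETRY (provable
now, M): TwistedSymmetry → any two ℚ-linearly independent logarithms of algebraic numbers (e.g. log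
2, log 3; πi, log 2) are algebraically independent over ℚ. Proof: by TwistImpliesLogHomogeneity a
relation may be taken homogeneous of degree D ≥ 1, so ℓ₂/ℓ₁ is algebraic and irrational, and e^{ℓ₂}
= e^{(ℓ₂/ℓ₁)ℓ₁} contradicts Gel'fond–Schneider (tree `gelfond_schneider_holds`). This is the
flagship open content of barrier B1 ("not even two algebraically independent logarithms are known").
[difficulty: provable-now] [Gelfond1934, Waldschmidt2004, Denis1995, tree:
Literature.NumberTheory.Transcendental.gelfond_schneider_holds]
#9 TwistInZilberFields (support) — RESISTANCE CERTIFICATE (L, from the named fact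
`zilber_categoricity`): in every uncountable Zilber field K and for every algebraic μ ≠ 0 there is a
ring endomorphism σ with σ(exp(μz)) = exp(σ z) — (K, exp∘μ) satisfies Zilber's axioms verbatim
(kernel (τ/μ)ℤ, SP because x ↦ μx preserves ℚ-linear dimension and is inter-algebraic over ℚ̄,
rotund/free varieties map to rotund/free under (x,y) ↦ (μx,y)), so categoricity gives an
E-isomorphism. Hence a refutation of TwistedSymmetry is a refutation of ℂ_exp ≅ 𝔹 (modulo the
ℚ̄-pointwise normalisation). [difficulty: L] [Zilber2005, BaysKirby2018ANT, Kirby2013FPEF]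

TWO-LAYER PLAN. TwistImpliesTowerPi ⇐ (TowerOrbitFormula: σ^k ∘ ev₁ = ev_{μ^k} on exp-terms, with
2πi ↦ 2πi/μ^k) → (DeformationTranscendence: m is
transcendental over the field of all deformations m ↦ ev_m(T), by Ax induction) →
TwistImpliesTowerPi (identity theorem + Ax accounting);
RelSchanuelOverTowerPi ⇐ (LogCore: Schanuel for tuples from the exp-closure of ℚ̄(𝓛), which TS
reduces to PROJECTIVE statements on the
σ-weight-(−1) part — four exponentials, Gel'fond ladders live here) → (DeepCore: iterated logarithms
of transcendentals and implicit Khovanskii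
points) → RelSchanuelOverTowerPi; TwistedSymmetry ⇐ (TwistOnEcl: a twisted endomorphism of the
countable field ecl(∅) suffices for every
support) → (extension to ℂ). None filed now.

KILL CRITERIA. TwistedSymmetry refuted (e.g. a theorem that every ring endomorphism σ of ℂ with
σ∘exp = exp∘(μσ) is continuous, or an inhomogeneous
ℚ-relation among logarithms of algebraic numbers, or any algebraic relation between e and π) ⇒ close
`refuted:TwistedSymmetry` — and record
that Zilber's conjecture dies with it (TwistInZilberFields). RelSchanuelOverTowerPi refuted ⇒
Schanuel is false; close every route.
TowerPiSchanuel proved elsewhere (e.g. CyclotomicRigidity's TowerSchanuel + π) does not moot the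
route: TS still carries e⊥π/log-homogeneity;
but if RelSchanuelOverTowerPi is shown EQUIVALENT to Schanuel (i.e. the sector is empty of content)
the route is superseded by CyclotomicRigidity.
A proof that TS ⟺ TowerPiSchanuel ∧ (nothing more) would downgrade TS to a costume of the sector —
pivot to the log-homogeneity line only.

NOT DECOMPOSED YET. The syntax of exp-terms / finite towers needed to state the orbit formula
(layer-2 child of TwistImpliesTowerPi; CyclotomicRigidity asked
for the same `expClosure` notion); the projective-Schanuel residue on the σ-weight-(−1) eigenspace
(where TS is silent by construction — the
honest core of B1: four exponentials is a HOMOGENEOUS log relation); the normalisation σ|ℚ̄ = id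
inside Zilber fields (TwistInZilberFields
is stated without it); any attempt to CONSTRUCT σ on ecl(∅) by back-and-forth (the only place an
unconditional engine could enter).

CHEAPEST FALSIFIER. (a) Logic, one page (done by the planner, NOTES.md §Critic): is TS trivially
false? σ = id/conj need μ = 1, excluded; fixing ℚ̄ is
consistent with the twist at every algebraic z (HL: e^z ∉ ℚ̄) and at logs (σ(log α) = log α/μ);
KMO2012 Thm 1 (real abelian numbers are
∅-definable in both (ℂ,exp) and (ℂ,exp∘μ), with equal values) is respected. (b) Numerics a refuter
can run in minutes: PSLQ at 300 digits
for INHOMOGENEOUS integer relations of degree ≤ 3 and height ≤ 10^6 among {2πi, log 2, log 3, log 5}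
— any certified hit refutes
TwistImpliesLogHomogeneity's conclusion, hence TS and Zilber's conjecture (expected: none). (c)
Lookup: a printed statement that
(ℂ, e^z) ≇ (ℂ, e^{μz}) for some algebraic μ, or that exp-semilinear endomorphisms of ℂ are
continuous — searched (Novelty), not found.

NUMBERS. Denis1995: q ≥ 3 needed (q − 1 = |F_q^×| ≥ 2; q = 3 gives ξ = −1, μ² = −1, μ = "i" ∈ F₉∖F₃
— the exact analogue of twisting exp by i);
ℤ^× = {±1} ↔ the excluded q = 2. Example twist: μ = (3+4i)/5 (degree 2, |μ| = 1, not a root of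
unity). Reach of TS worked out on paper:
e⊥π, π free over LW values, TowerSchanuel(+π), log-homogeneity, two logs, log α ⊥ α^β, log 2 ⊥
2^{log 2}; silent on: homogeneous log
relations (four exponentials), e^e-over-logs of weight 0, depth-≥2 logarithms. Items at open: 10 (2
cruxes, 7 supports, 1 assembly).

DEFINITION REQUESTS. None load-bearing (E is inlined as CyclotomicRigidity does). Convenience, after
open: `expClosure`/exp-term syntax with its evaluation
family ev_m (topic Literature/NumberTheory/Transcendental) for the provers of TwistImpliesTowerPi.
Bib added this session: Denis1995,
Pellarin2017, Mantova2011.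

Novelty: Searches (2026-08-16): `lit search --source s2 "Carlitz exponential algebraic independence Denis"`
(8: Pellarin arXiv:1610.04048, Denis
1994–2000); `--source zbmath "Denis Carlitz"` (15: Denis1995 doi:10.4064/aa-69-1-75-89 READ
pp.1-4,12-15; Duke 1995; BAMS 2006);
`--source zbmath "automorphisms complex exponential field"` (8, none relevant); `--source s2
"pseudo-exponentiation automorphism"` (8: Zilber2005,
Kirby 2014 fm232); `--source zbmath "Schanuel conjecture automorphism"` (8: KMO2012 arXiv:1101.4224
READ §1-2, Mantova2011 arXiv:1109.6155
READ §1, Zilber 2016 arXiv:1501.03301); `--source arxiv "exponentially closed field automorphism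
Zilber"` (2: Mantova2011, Kirby blurred
arXiv:1705.04574); `lit galaxy search "automorphism of the complex exponential field" --star all`
(0), `"isomorphic exponential fields" --star
all` (0); BaysKirby2018ANT arXiv:1512.04262 grep (variants = other analytic correspondences, no
rescaling twist); local searchd DOWN all
session (ConnectionReset), OpenAlex 429 — recorded. In-project: CyclotomicRigidity route file read
in full; cards conjugation-discount,
carlitz-mirror (closed vacuous), nome-one-over-e (closed; misreads Denis's proof as
Mahler/Frobenius) checked.
Nearest prior art found: Denis1995 Thm 3/Cor 2 (the char-p theorem transferred); CyclotomicRigidity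
(route-Schanuel-CyclotomicRigidity:
untwisted Galois extension on E, π excluded, GalExtTower ⇐ TowerSchanuel); KirbyMacintyreOnshuus2012
+ Mantova2011 (automorphisms of
exponential fiel  [refs: 10.4064/aa-69-1-75-89, 1610.04048, 1101.4224, 1109.6155, 1501.03301, 1705.04574, 1512.04262, doi:10.4064/aa-69-1-75-89, Denis1995, Zilber2005, Mantova2011, KirbyMacintyreOnshuus2012]

Barriers (technique_class: twisted-outer-automorphism, char-p-transfer, deformation): - technique_class: twisted-outer-automorphism, char-p-transfer, deformation
- Literature.Barriers.Schanuel.AxSchanuelFunctionalNotNumerical: applies to the deformation step and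
is evaded, not ignored — Ax is used only AFTER TS has converted the numerical relation at m = 1 into
a functional identity in the deformation parameter m (zeros on the dense orbit μ^ℕ ⊂ S¹); the
non-soft input is TS itself, which FAILS in exponential fields with a kernel relation (Bays–Kirby
𝔹_P with P(e,τ) = 0: there TS + LW would give e ⊥ τ), so nothing is derived from functional
transcendence alone.
- Literature.Barriers.Schanuel.AxiomsDoNotForceSchanuel: respected — TS is not a consequence of
Zilber's axioms minus SP (it fails in 𝔹_P) and nothing is transferred from abstract axioms to ℂ;
TwistInZilberFields only certifies that refuting TS refutes ℂ_exp ≅ 𝔹.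
- Literature.Barriers.Schanuel.SchanuelPropertyNotFirstOrder: not triggered — TS is a second-order
statement about one field ℂ (existence of an endomorphism), no elementary transfer, no ultrapowers.
- Literature.Barriers.Schanuel.EFunctionValuesAtAlgebraicPoints: evaded exactly as Denis evades
Thiery's restriction: LW is applied only at the ALGEBRAIC points μ^k·α manufactured by the twist;
e⊥π needs no value of an E-function at a transcendental point.
- Literature.Barriers.Schanuel.AlgebraicIndependenceOfLogarithms: the route says where two
independent logarithms come from — TS makes all log relations homogeneous, and Gel'fond–Schneider
kills ho

sub-problem: Schanuel · status: draft · opened planner-plan-novel-Schanuel-Schanuel-03fec9a6-b-v2-g12-0 2026-08-16T22:55:15Z · rev 1 · ledger route-Schanuel-TwistedConjugacy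
GENERATED by the gate from the ledger (D-0016/17). Provers cite these decls: `theorem foo : Summit.Schanuel.Schanuel.Theses.TwistedConjugacy.<Decl> := …` in Summits/Schanuel/Schanuel/Theorems/<Name>.lean.
-/

namespace Summit.Schanuel.Schanuel.Theses.TwistedConjugacy

open scoped BigOperators Topology Manifold Classical MeasureTheory ProbabilityTheory Matrix InnerProductSpace ComplexConjugate ContinuousMap
open Filter Set Function TopologicalSpace MeasureTheory

attribute [summit_statement] _root_.Schanuel

open Literature.Periods

/-- item stmt-Schanuel-17222 · crux · rank 2 · open · by planner
why it might fail: false iff ℂ_exp ≇ (ℂ, exp∘μ) over ℚ̄ — refutes Zilber's ℂ_exp ≅ 𝔹 (both satisfy his axioms); it forces e⊥π, log2⊥log3, TowerSchanuel; no wild exp-semilinear endomorphism of ℂ has ever been built (Aut ℂ_exp ⊋ {1,c} open).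
sources: Denis1995, Zilber2005, BaysKirby2018ANT, Mantova2011, KirbyMacintyreOnshuus2012
[crux] there exist an algebraic μ ∈ ℂ with |μ| = 1, μ not a root of unity, and a ring endomorphism σ
: ℂ → ℂ fixing every algebraic number pointwise with σ(exp z) = exp(μ·σ z) for all z ("exp is wildly
conjugate to exp∘μ"; the transferred Denis automorphism). [difficulty: open-problem] -/
@[route_item "route-Schanuel-TwistedConjugacy", crux]
def TwistedSymmetry : Prop :=
  ∃ μ : ℂ, IsAlgebraic ℚ μ ∧ ‖μ‖ = 1 ∧ (∀ n : ℕ, 0 < n → μ ^ n ≠ 1) ∧ ∃ σ : ℂ →+* ℂ, (∀ a : ℂ, IsAlgebraic ℚ a → σ a = a) ∧ ∀ z : ℂ, σ (Complex.exp z) = Complex.exp (μ * σ z)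

/-- item stmt-Schanuel-17223 · crux · rank 3 · open · by planner
why it might fail: iff Schanuel fails off the sector E ⊕ ℚ2πi: contains log 2 ⊥ log 3 over E (barrier AlgebraicIndependenceOfLogarithms in full), log π, implicit Khovanskii points; TS only removes inhomogeneous log relations there — no engine for the rest.
sources: Kirby2010, Waldschmidt2000, Lang1966, Kirby2013FPEF
[crux] Schanuel relative to the base field E(2πi), E the exp-closure of ℚ̄: if z₁,…,zₙ are
ℚ-linearly independent modulo E + ℚ·2πi, then trdeg over E(2πi) of E(2πi)(z, e^z) is ≥ n. The honest
remainder once TS has absorbed the tower and π; strictly weaker than CyclotomicRigidity's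
TowerStrong ∧ PiNotInTower. [difficulty: open-problem] -/
@[route_item "route-Schanuel-TwistedConjugacy", crux]
def RelSchanuelOverTowerPi : Prop :=
  ∀ (n : ℕ) (z : Fin n → ℂ), (∀ (q : Fin n → ℚ) (r : ℚ), (∑ i, (q i : ℂ) * z i) + (r : ℂ) * (2 * (Real.pi : ℂ) * Complex.I) ∈ (sInf {K : IntermediateField ℚ ℂ | algebraicClosure ℚ ℂ ≤ K ∧ ∀ w ∈ K, Complex.exp w ∈ K} : IntermediateField ℚ ℂ) → q = 0) → (n : Cardinal) ≤ Algebra.trdeg ↥(IntermediateField.adjoin ℚ (((sInf {K : IntermediateField ℚ ℂ | algebraicClosure ℚ ℂ ≤ K ∧ ∀ w ∈ K, Complex.exp w ∈ K} : IntermediateField ℚ ℂ) : Set ℂ) ∪ {2 * (Real.pi : ℂ) * Complex.I})) ↥(IntermediateField.adjoin ↥(IntermediateField.adjoin ℚ (((sInf {K : IntermediateField ℚ ℂ | algebraicClosure ℚ ℂ ≤ K ∧ ∀ w ∈ K, Complex.exp w ∈ K} : IntermediateField ℚ ℂ) : Set ℂ) ∪ {2 * (Real.pi : ℂ) * Complex.I}))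 (Set.range z ∪ Set.range (Complex.exp ∘ z)))

/-- item stmt-Schanuel-17225 · crux · rank 9 · open · by planner
why it might fail: Identity-theorem step needs each exp-deformation m ↦ ev_m(T) analytic off a countable closed set not dense in S¹, plus 'm transcendental over the deformation field' (Ax induction); essential singularities dense on S¹, or a constant combination Σqᵢ·m·ev_m(Tᵢ) outside ℚ·2πi, break it.
sources: Ax1971, Denis1995, Kirby2013FPEF
[support] THE DEFORMATION THEOREM (paper proof in NOTES.md §Deformation): TwistedSymmetry →
TowerPiSchanuel. For an exp-term T over ℚ̄ and the twisted σ, σ^k(ev₁ T) = ev_{μ^k}(T) where ev_m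
reads exp as u ↦ e^{mu}, and σ^k(2πi) = 2πi/μ^k; a ℚ-relation P(z, e^z) = 0 therefore holds along m
∈ μ^ℕ, dense in S¹; each m ↦ ev_m(T) is analytic off a countable closed set, so the identity theorem
gives P ≡ 0 in m, and Ax's theorem (tree `ax_schanuel`, derivation d/dm, y = m·ev_m(T), z = e^y)
plus "m is transcendental over the deformation field" (Ax induction) yield trdeg ≥ n. [difficulty:
XL] -/
@[route_item "route-Schanuel-TwistedConjugacy", crux]
def TwistImpliesTowerPi : Prop :=
  (∃ μ : ℂ, IsAlgebraic ℚ μ ∧ ‖μ‖ = 1 ∧ (∀ n : ℕ, 0 < n → μ ^ n ≠ 1) ∧ ∃ σ : ℂ →+* ℂ, (∀ a : ℂ, IsAlgebraic ℚ a → σ a = a) ∧ ∀ z : ℂ, σ (Complex.exp z) = Complex.exp (μ * σ z)) → (∀ (n : ℕ) (z : Fin n → ℂ), (∀ i, ∃ r : ℚ, z i + (r : ℂ) * (2 * (Real.pi : ℂ) * Complex.I) ∈ (sInf {K : IntermediateField ℚ ℂ | algebraicClosure ℚ ℂ ≤ K ∧ ∀ w ∈ K, Complex.exp w ∈ K} :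 IntermediateField ℚ ℂ)) → LinearIndependent ℚ z → (n : Cardinal) ≤ Algebra.trdeg ℚ ↥(IntermediateField.adjoin ℚ (Set.range z ∪ Set.range (Complex.exp ∘ z))))

/-- item stmt-Schanuel-17224 · support · rank 9 · open · by planner
sources: Macintyre1991, Kirby2013FPEF, Lang1966
[support] SCHANUEL ON THE SECTOR E ⊕ ℚ·2πi: for z₁,…,zₙ ℚ-linearly independent with each zᵢ ∈ E +
ℚ·2πi, trdeg ℚ(z, e^z) ≥ n (contains CyclotomicRigidity's TowerSchanuel, e ⊥ e^e, e ⊥ π, and "π free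
over the tower"); the consequent of TwistImpliesTowerPi, filed as its own statement. [difficulty:
open-problem] -/
@[route_item "route-Schanuel-TwistedConjugacy"]
def TowerPiSchanuel : Prop :=
  ∀ (n : ℕ) (z : Fin n → ℂ), (∀ i, ∃ r : ℚ, z i + (r : ℂ) * (2 * (Real.pi : ℂ) * Complex.I) ∈ (sInf {K : IntermediateField ℚ ℂ | algebraicClosure ℚ ℂ ≤ K ∧ ∀ w ∈ K, Complex.exp w ∈ K} : IntermediateField ℚ ℂ)) → LinearIndependent ℚ z → (n : Cardinal) ≤ Algebra.trdeg ℚ ↥(IntermediateField.adjoin ℚ (Set.range z ∪ Set.range (Complex.exp ∘ z)))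

/-- item stmt-Schanuel-17226 · support · rank 9 · open · by planner
sources: Denis1995, Weierstrass1885, BakerTNT1975, tree: Literature.NumberTheory.Transcendental.LindemannWeierstrass.AlgIndep_holds
[support] FIRST DELIVERABLE, Denis's argument verbatim (provable now, M): TwistedSymmetry → e and π
algebraically independent. σ fixes ζ_N = e^{2πi/N} for all N, so σ(2πi) = 2πi/μ and σ(π) = π/μ; if
Q(π, e) = 0 then σ^k gives Q(π/μ^k, e^{μ^k}) = 0, so every e^{μ^k} is algebraic over ℚ(π); μ ∉ ℚ has
degree d ≥ 2 and LW (tree `LindemannWeierstrass.AlgIndep_holds`) makes e, e^μ, …, e^{μ^{d−1}}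
algebraically independent inside a field of trdeg 1 — contradiction. [difficulty: provable-now] -/
@[route_item "route-Schanuel-TwistedConjugacy"]
def TwistImpliesEPi : Prop :=
  (∃ μ : ℂ, IsAlgebraic ℚ μ ∧ ‖μ‖ = 1 ∧ (∀ n : ℕ, 0 < n → μ ^ n ≠ 1) ∧ ∃ σ : ℂ →+* ℂ, (∀ a : ℂ, IsAlgebraic ℚ a → σ a = a) ∧ ∀ z : ℂ, σ (Complex.exp z) = Complex.exp (μ * σ z)) → AlgebraicIndependent ℚ ![Complex.exp 1, (Real.pi : ℂ)]

/-- item stmt-Schanuel-17227 · support · rank 9 · open · by planner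
sources: Denis1995, Ax1971, Waldschmidt2004, tree: Literature.NumberTheory.Transcendental.LindemannWeierstrass.AlgIndep_holds
[support] π IS FREE OVER THE LINDEMANN–WEIERSTRASS VALUES (provable, L): TwistedSymmetry → for
algebraic α₁,…,αₙ ℚ-linearly independent, trdeg ℚ(π, e^{α₁},…,e^{αₙ}) = n+1. One-μ proof by
deformation: P(2πi/m, e^{mα}) vanishes on μ^ℕ ⊂ S¹ (dense), hence identically; 1/m and the e^{mαᵢ}
are algebraically independent functions (Ax), so P = 0. (The GaussianStokesSector sector statement,
reached by symmetry instead of Stokes data; CyclotomicRigidity's LWWithPi is its linear shadow.)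
[difficulty: L] -/
@[route_item "route-Schanuel-TwistedConjugacy"]
def TwistImpliesPiFree : Prop :=
  (∃ μ : ℂ, IsAlgebraic ℚ μ ∧ ‖μ‖ = 1 ∧ (∀ n : ℕ, 0 < n → μ ^ n ≠ 1) ∧ ∃ σ : ℂ →+* ℂ, (∀ a : ℂ, IsAlgebraic ℚ a → σ a = a) ∧ ∀ z : ℂ, σ (Complex.exp z) = Complex.exp (μ * σ z)) → ∀ (n : ℕ) (α : Fin n → ℂ), (∀ i, IsAlgebraic ℚ (α i)) → LinearIndependent ℚ α → ((n + 1 : ℕ) : Cardinal) ≤ Algebra.trdeg ℚ ↥(IntermediateField.adjoin ℚ (insert (Real.pi : ℂ) (Set.range (Complex.exp ∘ α))))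

/-- item stmt-Schanuel-17228 · support · rank 9 · open · by planner
sources: Denis1995, BakerTNT1975, Mathlib: Matrix.det_vandermonde
[support] BAKER'S INHOMOGENEITY PRINCIPLE IN ALL DEGREES (provable now, S): TwistedSymmetry → every
ℚ-polynomial relation P(ℓ) = 0 among logarithms ℓⱼ of algebraic numbers (e^{ℓⱼ} ∈ ℚ̄; no
independence hypothesis) holds homogeneous component by component. Proof: all roots e^{ℓⱼ/N} are
algebraic hence σ-fixed, forcing σ(ℓⱼ) = ℓⱼ/μ exactly; so P(ℓ/μ^k) = Σ_d μ^{−kd} P_d(ℓ) = 0 for k =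
0..deg P, a Vandermonde system in the distinct nodes μ^{−d}. [difficulty: provable-now] -/
@[route_item "route-Schanuel-TwistedConjugacy"]
def TwistImpliesLogHomogeneity : Prop :=
  (∃ μ : ℂ, IsAlgebraic ℚ μ ∧ ‖μ‖ = 1 ∧ (∀ n : ℕ, 0 < n → μ ^ n ≠ 1) ∧ ∃ σ : ℂ →+* ℂ, (∀ a : ℂ, IsAlgebraic ℚ a → σ a = a) ∧ ∀ z : ℂ, σ (Complex.exp z) = Complex.exp (μ * σ z)) → ∀ (r : ℕ) (l : Fin r → ℂ), (∀ j, IsAlgebraic ℚ (Complex.exp (l j))) → ∀ P : MvPolynomial (Fin r) ℚ, MvPolynomial.aeval l P = 0 → ∀ d : ℕ, MvPolynomial.aeval l (MvPolynomial.homogeneousComponent d P) = 0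

/-- item stmt-Schanuel-17229 · support · rank 9 · open · by planner
sources: Gelfond1934, Waldschmidt2004, Denis1995, tree: Literature.NumberTheory.Transcendental.gelfond_schneider_holds
[support] TWO ALGEBRAICALLY INDEPENDENT LOGARITHMS FROM SYMMETRY (provable now, M): TwistedSymmetry
→ any two ℚ-linearly independent logarithms of algebraic numbers (e.g. log 2, log 3; πi, log 2) are
algebraically independent over ℚ. Proof: by TwistImpliesLogHomogeneity a relation may be taken
homogeneous of degree D ≥ 1, so ℓ₂/ℓ₁ is algebraic and irrational, and e^{ℓ₂} = e^{(ℓ₂/ℓ₁)ℓ₁}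
contradicts Gel'fond–Schneider (tree `gelfond_schneider_holds`). This is the flagship open content
of barrier B1 ("not even two algebraically independent logarithms are known"). [difficulty:
provable-now] -/
@[route_item "route-Schanuel-TwistedConjugacy"]
def TwistImpliesTwoLogs : Prop :=
  (∃ μ : ℂ, IsAlgebraic ℚ μ ∧ ‖μ‖ = 1 ∧ (∀ n : ℕ, 0 < n → μ ^ n ≠ 1) ∧ ∃ σ : ℂ →+* ℂ, (∀ a : ℂ, IsAlgebraic ℚ a → σ a = a) ∧ ∀ z : ℂ, σ (Complex.exp z) = Complex.exp (μ * σ z)) → ∀ l : Fin 2 → ℂ, (∀ j, IsAlgebraic ℚ (Complex.exp (l j))) → LinearIndependent ℚ l → AlgebraicIndependent ℚ l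

/-- item stmt-Schanuel-17230 · support · rank 9 · open · by planner
sources: Zilber2005, BaysKirby2018ANT, Kirby2013FPEF
[support] RESISTANCE CERTIFICATE (L, from the named fact `zilber_categoricity`): in every
uncountable Zilber field K and for every algebraic μ ≠ 0 there is a ring endomorphism σ with
σ(exp(μz)) = exp(σ z) — (K, exp∘μ) satisfies Zilber's axioms verbatim (kernel (τ/μ)ℤ, SP because x ↦
μx preserves ℚ-linear dimension and is inter-algebraic over ℚ̄, rotund/free varieties map to
rotund/free under (x,y) ↦ (μx,y)), so categoricity gives an E-isomorphism. Hence a refutation of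
TwistedSymmetry is a refutation of ℂ_exp ≅ 𝔹 (modulo the ℚ̄-pointwise normalisation). [difficulty:
L] -/
@[route_item "route-Schanuel-TwistedConjugacy"]
def TwistInZilberFields : Prop :=
  Literature.NumberTheory.Transcendental.zilber_categoricity → ∀ (K : Type) [Field K] [CharZero K] [Literature.ModelTheory.ExponentialFields.ExponentialRing K], Literature.NumberTheory.Transcendental.IsZilberField K → Cardinal.aleph0 < Cardinal.mk K → ∀ μ : K, IsAlgebraic ℚ μ → μ ≠ 0 → ∃ σ : K →+* K, ∀ z : K, σ (Literature.ModelTheory.ExponentialFields.ExponentialRing.exp (μ * z)) = Literature.ModelTheory.ExponentialFields.ExponentialRing.exp (σ z)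

/-- item stmt-Schanuel-17231 · assembly · rank 1 · open · by planner
sources: Waldschmidt2000, Kirby2010, Mathlib: Algebra.trdeg_add_eq
[assembly] TowerPiSchanuel → RelSchanuelOverTowerPi → Schanuel (split span_ℚ z along E ⊕ ℚ2πi; tower
law for trdeg). -/
@[route_item "route-Schanuel-TwistedConjugacy", crux]
def Assembly : Prop :=
  TowerPiSchanuel → RelSchanuelOverTowerPi → Schanuel

/-! D-0027 §2.1 — DECIDING THEOREM (planner-authored via `route open/edit --closes-file`; by planner-plan-novel-Schanuel-Schanuel-03fec9a6-b-v2-g12-0 2026-08-16T22:55:15Z):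
its hypotheses are this route's items and its conclusion the sub-problem Statement (glue_lint), and it elaborates with this file. -/

@[closes "route-Schanuel-TwistedConjugacy"] theorem closes (hD : TwistImpliesTowerPi) (hT : TwistedSymmetry) (hR : RelSchanuelOverTowerPi) (hA : Assembly) : _root_.Schanuel :=
  hA (hD hT) hR

end Summit.Schanuel.Schanuel.Theses.TwistedConjugacy
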